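import Literature.AlgebraicGeometry.Motives.AbelianVarietyAmpleRiemannForm
import Literature.AlgebraicGeometry.Motives.AbelianVarietyPolarizationTypeAnalytic
import Literature.Geometry.Kaehler.ComplexTorusPositiveLineBundleH0
import HarnessLib

/-!
# `h⁰(𝒪_A(Θ)^an)² = #K(Θ)(ℂ)` for an ample divisor on a complex abelian variety
# (Mumford, *Abelian Varieties*, §16: the Riemann–Roch theorem `χ(L)² = deg φ_L` with the vanishing theorem — ANALYTIC side)

Layer `Literature/AlgebraicGeometry/HodgeTheory`, namespace `Literature.AlgebraicGeometry.Motives.AbelianVariety` (variable block of ★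
`AbelianVarietyAmpleRiemannForm` / ★ `AbelianVarietyPolarizationTypeAnalytic`: a complex abelian variety `A` with a torus uniformisation
`φ : X = V/Φ(ℤ^ι) → A(ℂ)` compatible with the group laws).  THEOREMS ONLY (no definition, no named fact, no instance, no `sorry`).

For a Cartier divisor `Θ` on `A`, `𝒪_A(Θ)^an = cartierDivisorLineBundle hφ Θ` is the analytified cocycle line bundle on the torus (★
`HodgeTheory/CartierDivisorChernClass`), with `h⁰ = dim_ℂ` of its holomorphic sections (★ `HolomorphicLineBundle.h0`), and `K(Θ) ⊆ A(ℂ)` is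
Mumford's group `{x ; t_x^*Θ ∼ Θ}` (★ `AbelianVariety.KTheta`).

* `h0_cartierDivisorLineBundle_eq_h0_lineBundleAH` — for ANY Appell–Humbert datum `p = (H, χ)` of the class of `𝒪(Θ)^an`
  (`AHData.toPic p = [𝒪(Θ)^an]`): `h⁰(𝒪(Θ)^an) = h⁰(L(H, χ))` — sections are theta functions for the factor of a frame of `π^*L`
  (★ `IsCoverFrame.thetaEquivOfFrame`, [Lange2023] Prop. 1.2.3), that factor is equivalent to the canonical factor `a_p` (★
  `exists_coboundary_of_isTrivialOn_tensor_inv_of_isTrivialOn`, ★ `picClass_eq_toPic_iff`), and equivalent factors have isomorphic theta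
  spaces (★ `thetaFunctionsEquivOfCoboundary`);
* **`h0_cartierDivisorLineBundle_sq_eq_natCard_KTheta`** — for `Θ` AMPLE: **`h⁰(𝒪(Θ)^an)² = #K(Θ)(ℂ)`**: `H > 0` (★ `isRiemannForm_of_isAmple`,
  [Lange2023] Prop. 2.1.11), `#K(H) = h⁰(L(H,χ))²` (★ `IsRiemannForm.natCard_kerPhiH_eq_h0_sq`, [Lange2023] Cor. 1.7.2 with Prop. 1.4.7 and
  Thm. 1.5.9), and `K(H) ≃ K(Θ)(ℂ)` along `φ` (★ `nonempty_kerPhiH_addEquiv_KTheta`, [Lange2023] (1.14));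
  `finrank_sectionSpace_cartierDivisorLineBundle_sq_eq_natCard_KTheta` — the same with `Module.finrank` displayed.

This is the ANALYTIC half (R2-an) of the RANK brick of the cell's F-2 (b) field case (census `B-provers/B-p05/g17/CENSUS-F2b-Rank.B-p05g17.md`,
road (a) of record, B-plan1 (g16) 2026-08-30T07:48:31Z): with the GAGA comparison (R1) `h⁰(𝒪(Θ)^an) = dim_ℂ Γ(A, 𝒪_A(Θ))` it gives the
algebraic `h⁰(A, 𝒪(Θ))² = #K(Θ)`, and with ★ `natCard_kOfL_eq_polarizationDegree_sq` (B-p08 (g12)) the number `h⁰(A_s̄, L^Δ(λ)_s̄^{⊗3}) = 6^g ∏δᵢ`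
consumed by the F-6 (VI) embedding package (transport `ℂ ⇝ Ω` = R3).  Count-neutral; HC_CM is proved only modulo the 7 printed citations until
rung 0 closes — nothing here refers to it.

## References
* [MumfordAV1970] D. Mumford, *Abelian Varieties*, TIFR Studies in Mathematics 5 (1970), §16 (the Riemann–Roch theorem and the vanishing theorem).
* [Lange2023AbelianVarietiesComplex] H. Lange, *Abelian Varieties over the Complex Numbers* (2023), §1.2.1 Prop. 1.2.3, §1.4.2 Prop. 1.4.7 and (1.14),
  §1.5 Thm. 1.5.9, §1.7.1 Cor. 1.7.2, §2.1.3 Prop. 2.1.11.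
-/

noncomputable section

open Set Function CategoryTheory AlgebraicGeometry
open scoped Manifold ContDiff Topology
open Literature.AlgebraicGeometry.Motives Literature.Geometry.Kaehler Literature.Geometry.Kaehler.ComplexTorus
open Literature.NumberTheory.Transcendental Literature.AlgebraicGeometry.HodgeTheory

namespace Literature.AlgebraicGeometry.Motives.AbelianVariety

section Uniformised

variable (A : AbelianVariety ℂ) {ι : Type} [Fintype ι] [DecidableEq ι] {Φ : (ι → ℝ) ≃L[ℝ] (Fin A.dim → ℂ)}
  {φ : ComplexTorus Φ → ComplexPoints A.X} (hφ : IsAnalytification (Fin A.dim → ℂ) A.X A.dim φ)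
  (hadd : ∀ x y, φ (x + y) = φ x * φ y)

omit [DecidableEq ι] in
/-- **`h⁰(𝒪(Θ)^an) = h⁰(L(H, χ))`** for every Appell–Humbert datum `p = (H, χ)` of the class of `𝒪_A(Θ)^an` on the uniformising torus:
the global holomorphic sections of `L = 𝒪(Θ)^an` are the theta functions of the factor of a frame of `π^*L` ([Lange2023] Prop. 1.2.3),
which is equivalent to the canonical factor `a_p` (Prop. 1.2.2), and equivalent factors have isomorphic spaces of theta functions.
[cite: Lange2023AbelianVarietiesComplex, §1.2.1 Prop. 1.2.2–1.2.3 (pp. 21–22) and §1.3.1 Lemma 1.3.1] -/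
theorem h0_cartierDivisorLineBundle_eq_h0_lineBundleAH (Θ : CartierDivisor A.X.left) (p : AHData Φ)
    (hp : AHData.toPic p = picClass (cartierDivisorLineBundle hφ Θ)) :
    (cartierDivisorLineBundle hφ Θ).h0 = (lineBundleAH p.isNSForm_form p.isSemicharacter_char).h0 := by
  set L := cartierDivisorLineBundle hφ Θ with hL
  -- a frame of `π^*L` and the factor of the frame
  obtain ⟨s, hs⟩ := exists_isCoverFrame L
  -- `L ≅ L(a_p)`
  have htriv : (L.tensor (AHData.toFactor p)⁻¹.lineBundle).IsTrivialOn univ :=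
    (picClass_eq_toPic_iff L (AHData.toFactor p)).1 (hp.symm.trans (AHData.toPic_apply p))
  -- the factor of the frame and `a_p` are equivalent through a coboundary `K`
  obtain ⟨K, hK, hK0, hrel⟩ := exists_coboundary_of_isTrivialOn_tensor_inv_of_isTrivialOn hs.isFactor (AHData.toFactor p).isFactor
    hs.isTrivialOn_tensor_factorLineBundle_inv htriv
  calc L.h0 = Module.finrank ℂ (thetaFunctions Φ (factorOfFrame L s)) := hs.finrank_thetaFunctions_eq_h0.symm
    _ = Module.finrank ℂ (thetaFunctions Φ (AHData.toFactor p)) :=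
      LinearEquiv.finrank_eq (thetaFunctionsEquivOfCoboundary Φ hK hK0 hrel)
    _ = (factorLineBundle (AHData.toFactor p).isFactor).h0 := finrank_thetaFunctions_eq_h0 (AHData.toFactor p).isFactor
    _ = (lineBundleAH p.isNSForm_form p.isSemicharacter_char).h0 := rfl

include hadd

/-- **`h⁰(𝒪(Θ)^an)² = #K(Θ)(ℂ)` for `Θ` ample on a complex abelian variety** (Mumford §16: Riemann–Roch `χ(L)² = deg φ_L` with the
vanishing theorem `χ(L) = h⁰(L)`; here: Lange Cor. 1.7.2 / Prop. 1.4.7 / Thm. 1.5.9 for the POSITIVE `L(H, χ) ≅ 𝒪(Θ)^an`, positivity by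
Prop. 2.1.11, and `K(H) ≃ K(Θ)(ℂ)` along the uniformisation). [cite: MumfordAV1970, §16 (the Riemann–Roch theorem)]
[cite: Lange2023AbelianVarietiesComplex, §1.7.1 Cor. 1.7.2, §1.4.2 Prop. 1.4.7 and (1.14), §2.1.3 Prop. 2.1.11 (p. 80)] -/
theorem h0_cartierDivisorLineBundle_sq_eq_natCard_KTheta (Θ : CartierDivisor A.X.left) (hΘ : Θ.IsAmple) :
    (cartierDivisorLineBundle hφ Θ).h0 ^ 2 = Nat.card (A.KTheta Θ) := by
  -- an Appell–Humbert datum of `𝒪(Θ)^an`, positive since `Θ` is ample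
  obtain ⟨p, hp⟩ := AHData.toPic_surjective (picClass (cartierDivisorLineBundle hφ Θ))
  have hR : IsRiemannForm Φ p.form := A.isRiemannForm_of_isAmple hφ hadd hΘ p hp
  have hG : (intGram Φ p.form).map (Int.cast : ℤ → ℝ) = latticeGram Φ p.form := map_intGram Φ p.isNSForm_form
  -- `#K(H) = h⁰(L(H, χ))²` and `K(H) ≃ K(Θ)(ℂ)`
  have h1 := hR.natCard_kerPhiH_eq_h0_sq hG p.isSemicharacter_char
  obtain ⟨e⟩ := A.nonempty_kerPhiH_addEquiv_KTheta hφ hadd Θ p hp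
  rw [A.h0_cartierDivisorLineBundle_eq_h0_lineBundleAH hφ Θ p hp]
  exact h1.symm.trans (Nat.card_congr e.toEquiv)

/-- The same with the dimension displayed: **`(dim_ℂ H⁰(X, 𝒪(Θ)^an))² = #K(Θ)(ℂ)`** for `Θ` ample.
[cite: MumfordAV1970, §16 (the Riemann–Roch theorem)] [cite: Lange2023AbelianVarietiesComplex, §1.7.1 Cor. 1.7.2 and §2.1.3 Prop. 2.1.11 (p. 80)] -/
theorem finrank_sectionSpace_cartierDivisorLineBundle_sq_eq_natCard_KTheta (Θ : CartierDivisor A.X.left) (hΘ : Θ.IsAmple) :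
    Module.finrank ℂ (cartierDivisorLineBundle hφ Θ).sectionSpace ^ 2 = Nat.card (A.KTheta Θ) :=
  A.h0_cartierDivisorLineBundle_sq_eq_natCard_KTheta hφ hadd Θ hΘ

end Uniformised

end Literature.AlgebraicGeometry.Motives.AbelianVariety

end
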